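import Summits.QuantumFields.YangMills.Theorems.BalabanLadderIRColdDoublingRecursionSC
import Summits.QuantumFields.YangMills.Theorems.BalabanLadderIRAbstractBasinRung24
import Literature.MathematicalPhysics.QuantumLattice.GaugeGroupsProofs
import Literature.MathematicalPhysics.QuantumLattice.RepLieAlgebraUnitary
import HarnessLib

/-!
# Line `femto-wall` (ideator ym-ir-idea-10 g2, lens «negation») on crux `IR` (stmt-QuantumFields-19354):
# the β-UNIFORMITY WALL of the seed `E` as a typed, refuted strengthening — at FIXED lattice box the cold purity
# defect tends to ONE as `β → ∞` (zero-mode tower), so every `E`-witness `L(β)` diverges in lattice units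

HONEST FRAMING.  Nothing here proves the Yang–Mills mass gap (Clay), `BalabanLadder.IR`, or the seed `E`; R4 closes only the
conditional finite-𝕋⁴ rung `BalabanLadder.UV`.  This file is NEGATIVE KNOWLEDGE about the SHAPE of `E = ColdExitAt θ`
(`∀ β ≫ 1, ∃ L ≥ 8, δᶜ_β(L) ≤ θ`; seed of the desk's lines 10/13 via `BasinRung.IR_of_exitAt24`): width toward `IR` is 0.
It posits ONE physical stub, `FemtoTowerSC` (group-blind within compact Lie groups; physics-certain; open in the tree), PROVES a new
two-sided dictionary `1/(1+x)² ≤ 1 − δᶜ ≤ 1/(1+x)` between the purity defect and the tree's thermal trace excess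
`x = exc` (`AspectBootstrap.exc`, `= Σ_{i≠0}(λᵢ/λ₀)^t = N_eff − 1`), and derives, sorry-free modulo the stub:
 * `E` WITH THE BOX CHOSEN BEFORE THE COUPLING (`UniformExitAt θ := … ∃ L ≥ 8, ∃ β₁, ∀ β ≥ β₁, δᶜ_β(L) ≤ θ`, a strengthening of
   `ColdExitAt θ`: `coldExitAt_of_uniformExitAt`) is FALSE for every `θ < 1` at `G = SU(2)` (`not_uniformExitAt_SU2`, modulo the stub — SHARP:
   `uniformExitAt_iff_one_le : UniformExitAt θ ↔ 1 ≤ θ`, the trivial side `coldExitAt_of_one_le` being outright —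
   and the binder fact `SimplyConnectedSpace SU(2)` = `S³`, not in the tree);
 * WINDOW ESCAPE: for every `L₁`, beyond some `β₂(L₁)` NO box `8 ≤ L ≤ L₁` is `θ`-pure (`window_escape`); hence every selector
   `β ↦ L(β)` witnessing `ColdExitAt θ` tends to `+∞` (`selector_tendsto_atTop`, `exitSelectors_diverge`);
 * purity is NOT inherited UPWARD in `β` at fixed lattice size (`not_upwardHeredity`: the β-reversal of idea-11's `M♭₂ =
   BasinHereditySlackSC` is false given cofinal exits) — the asymmetry of `M♭₂` is essential.
READING (FINITE-BOX-PURITY §6 «the seed escapes only because L(β) is free to grow», director-ym №16 (3) «what makes it uniform in β»,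
made kernel): NOTHING makes `E` uniform in `β` at fixed LATTICE size; an `E`-proof must produce boxes diverging in lattice units, i.e.
contain a unit map / multi-scale passage (census: AF is spent NECESSARILY) — complementary to line `lightmode-exposure` (the GROUP input:
`π₁ = 1` ∧ non-abelian).  The wall is honest-group-blind: the zero-mode tower exists for `U(1)` too (exact: `x ≍ β^{3/2}`); it is a
statement about the β-quantifier, not about confinement.

THE MECHANISM (femto universe on the lattice; Lüscher 1983, van Baal–Koller 1987, Coste–González-Arroyo–Korthals Altes–Söderberg–Tarancón
1985 «zero-momentum modes in periodic boxes»).  At fixed spatial torus `L³` (lattice units) and `β → ∞` the transfer matrix has a TOWER of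
levels collapsing onto the ground state: the holonomies of the `3·rank G` flat (torus-constant, commuting) directions move freely on a
compact moduli space with kinetic mass `∝ β`, level spacing `∝ 1/β`; the non-commuting constant modes have the quartic commutator
potential, spacing `∝ β^{-1/3}` (Lüscher's `g^{2/3}/L`).  Hence the thermal trace excess at ANY fixed temporal extent `t`,
`x_t(β, L³) = Σ_{i≠0}(λᵢ/λ₀)^t → ∞` (Morse–Bott count at the generic stratum: `x ≳ β^{3·rank/2}`; for `U(1)` exactly `β^{3/2}`:
the electric-flux Gaussian sums `Σ_e e^{−t e²/(2βL)}` per direction), and by the dictionary `δᶜ_β(L) ≥ x/(1+x) → 1`.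
For a FINITE gauge group the tower is absent and `δᶜ_β(L) → 1 − |G|/#Hom(ℤ⁴,G)` (`ℤ_N`: `1 − N⁻³`): the stub USES connectedness /
positive dimension, guaranteed by `IsCompactSimpleLieGroup`.

Refs: M. Lüscher, Nucl. Phys. B219 (1983) 233; P. van Baal, J. Koller, Ann. Phys. 174 (1987) 299; A. Coste, A. González-Arroyo,
C.P. Korthals Altes, B. Söderberg, A. Tarancón, Nucl. Phys. B262 (1985) 67; G. 't Hooft, Nucl. Phys. B153 (1979) 141 (flux sectors);
A. González-Arroyo, C.P. Korthals Altes, Nucl. Phys. B311 (1988) 433; M. Lüscher, Commun. Math. Phys. 54 (1977) 283 (transfer matrix);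
tree `AspectBootstrap.{HasSpectralDatum, exc, defect_facts, tracePositive}`, `BasinRung.{ColdExitAt, IR_of_exitAt24}`.
-/

set_option autoImplicit false

noncomputable section

open Filter Topology MeasureTheory
open Literature.MathematicalPhysics.QuantumFieldTheory Literature.MathematicalPhysics.QuantumLattice
open Summit.QuantumFields.YangMills.Cruxes.IR.ColdPurityBridge (coldDefect)
open Summit.QuantumFields.YangMills.Cruxes.IR.ColdPressurePincer (AFToColdPressure IRnsc)
open Summit.QuantumFields.YangMills.Cruxes.IR.AspectBootstrap
  (HasSpectralDatum exc phi exc_nonneg exc_antitone z_eq_exp_mul z_pos tracePositive)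
open Summit.QuantumFields.YangMills.Cruxes.IR.BasinRung (ColdExitAt IR_of_exitAt24 coldExitAt_mono)

namespace Summit.QuantumFields.YangMills.Cruxes.IR.FemtoWall

/-! ## §0 One-box dictionary (abstract, PROVED): `1/(1+x)² ≤ Z(2t)/Z(t)² ≤ 1/(1+x)`, `x = x_t` -/

section OneBox

variable {z : ℕ → ℝ}

/-- The period-doubling ratio in terms of the excesses: `Z(2t)/Z(t)² = (1 + x_{2t})/(1 + x_t)²` (`t = m+2`). -/
theorem ratio_eq_exc (m : ℕ) :
    z (2 * (m + 2)) / z (m + 2) ^ 2 = (1 + exc z (2 * (m + 2))) / (1 + exc z (m + 2)) ^ 2 ∨ 1 + exc z (m + 2) = 0 := by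
  by_cases hx0 : 1 + exc z (m + 2) = 0
  · exact Or.inr hx0
  left
  have e1 := z_eq_exp_mul z m
  have e2 : z (2 * (m + 2)) = Real.exp (((2 * (m + 2) : ℕ) : ℝ) * phi z) * (1 + exc z (2 * (m + 2))) := by
    have := z_eq_exp_mul z (2 * m + 2)
    rwa [show 2 * m + 2 + 2 = 2 * (m + 2) from by ring] at this
  have e3 : Real.exp (((2 * (m + 2) : ℕ) : ℝ) * phi z) = Real.exp (((m + 2 : ℕ) : ℝ) * phi z) ^ 2 := by
    rw [← Real.exp_nat_mul]; push_cast; ring_nf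
  have hE : 0 < Real.exp (((m + 2 : ℕ) : ℝ) * phi z) := Real.exp_pos _
  rw [e2, e3, e1]
  field_simp

/-- **Upper bound on the ratio (NEW direction; the large-excess regime):** `Z(2t)/Z(t)² ≤ 1/(1 + x_t)`, because `x_{2t} ≤ x_t`
(`exc_antitone`).  Equivalently `δ ≥ x/(1+x) = 1 − 1/N_eff`: a large thermal excess forces the defect toward ONE.
(The tree's `one_sub_ratio_ge_of_traceExcess` gives `δ ≥ 2x/(1+x)²`, sharp for small `x` but `→ 0` for large `x`.) -/
theorem ratio_le_inv_one_add_exc (h : HasSpectralDatum z) (m : ℕ) :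
    z (2 * (m + 2)) / z (m + 2) ^ 2 ≤ 1 / (1 + exc z (m + 2)) := by
  have hx1 := exc_nonneg h m
  have hx2 : 0 ≤ exc z (2 * (m + 2)) := by
    rw [show 2 * (m + 2) = (2 * m + 2) + 2 from by ring]; exact exc_nonneg h _
  have hx21 : exc z (2 * (m + 2)) ≤ exc z (m + 2) := by
    rw [show 2 * (m + 2) = (2 * m + 2) + 2 from by ring]; exact exc_antitone h (by omega)
  rcases ratio_eq_exc (z := z) m with hr | h0
  · rw [hr]
    have h1 : (1 + exc z (2 * (m + 2))) / (1 + exc z (m + 2)) ^ 2 ≤ (1 + exc z (m + 2)) / (1 + exc z (m + 2)) ^ 2 :=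
      div_le_div_of_nonneg_right (by linarith) (sq_nonneg _)
    have h2 : (1 + exc z (m + 2)) / (1 + exc z (m + 2)) ^ 2 = 1 / (1 + exc z (m + 2)) := by
      have hx0 : (1 + exc z (m + 2)) ≠ 0 := ne_of_gt (by linarith)
      field_simp
    rw [h2] at h1
    exact h1
  · exfalso; linarith

/-- **Lower bound on the ratio:** `1/(1 + x_t)² ≤ Z(2t)/Z(t)²` (because `x_{2t} ≥ 0`); equivalently `δ ≤ 1 − 1/N_eff²`. -/
theorem inv_sq_le_ratio (h : HasSpectralDatum z) (m : ℕ) :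
    1 / (1 + exc z (m + 2)) ^ 2 ≤ z (2 * (m + 2)) / z (m + 2) ^ 2 := by
  have hx1 := exc_nonneg h m
  have hx2 : 0 ≤ exc z (2 * (m + 2)) := by
    rw [show 2 * (m + 2) = (2 * m + 2) + 2 from by ring]; exact exc_nonneg h _
  rcases ratio_eq_exc (z := z) m with hr | h0
  · rw [hr]
    exact div_le_div_of_nonneg_right (by linarith) (sq_nonneg _)
  · exfalso; linarith

end OneBox

/-! ## §1 The dictionary for Wilson's cold box: `1 − 1/(1+x) ≤ δᶜ_β(L) ≤ 1 − 1/(1+x)²`, `x = x_{⌊L/4⌋}(β, L³)` -/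

section Model

variable {G : Type} [Group G] [TopologicalSpace G] [IsTopologicalGroup G] [CompactSpace G]
  [MeasurableSpace G] [BorelSpace G]

/-- The thermal trace excess of the cold box: `x_{⌊L/4⌋}(β, L³) = Z_β(L³×⌊L/4⌋)/λ₀(β,L³)^{⌊L/4⌋} − 1 = Σ_{i≠0}(λᵢ/λ₀)^{⌊L/4⌋}`
(the tree's `AspectBootstrap.exc` of the time-slot sequence of Wilson's partition function; `N_eff = 1 + x` is the thermal
multiplicity of the ground state at temperature `1/⌊L/4⌋` in lattice units). -/
def coldExcess (r : LatticeRep G) (β : ℝ) (L : ℕ) : ℝ :=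
  exc (wilsonFinTorusPartition r.ρ β L L L) (L / 4)

/-- **δᶜ ≥ 1 − 1/(1+x)** (`β ≥ 0`, `L ≥ 8`): a large thermal excess makes the cold box impure. -/
theorem one_sub_inv_le_coldDefect (r : LatticeRep G) {β : ℝ} (hβ : 0 ≤ β) {L : ℕ} (hL : 8 ≤ L) :
    1 - 1 / (1 + coldExcess r β L) ≤ coldDefect r.ρ β L := by
  obtain ⟨m, hm⟩ : ∃ m, L / 4 = m + 2 := ⟨L / 4 - 2, by omega⟩
  have hd : HasSpectralDatum (wilsonFinTorusPartition r.ρ β L L L) :=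
    tracePositive r hβ L L L (by omega) (by omega) (by omega)
  have h := ratio_le_inv_one_add_exc hd m
  unfold coldExcess coldDefect
  rw [hm]
  linarith

/-- **δᶜ ≤ 1 − 1/(1+x)²** (`β ≥ 0`, `L ≥ 8`): conversely the defect controls the excess from below. -/
theorem coldDefect_le_one_sub_inv_sq (r : LatticeRep G) {β : ℝ} (hβ : 0 ≤ β) {L : ℕ} (hL : 8 ≤ L) :
    coldDefect r.ρ β L ≤ 1 - 1 / (1 + coldExcess r β L) ^ 2 := by
  obtain ⟨m, hm⟩ : ∃ m, L / 4 = m + 2 := ⟨L / 4 - 2, by omega⟩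
  have hd : HasSpectralDatum (wilsonFinTorusPartition r.ρ β L L L) :=
    tracePositive r hβ L L L (by omega) (by omega) (by omega)
  have h := inv_sq_le_ratio hd m
  unfold coldExcess coldDefect
  rw [hm]
  linarith

theorem coldExcess_nonneg (r : LatticeRep G) {β : ℝ} (hβ : 0 ≤ β) {L : ℕ} (hL : 8 ≤ L) : 0 ≤ coldExcess r β L := by
  obtain ⟨m, hm⟩ : ∃ m, L / 4 = m + 2 := ⟨L / 4 - 2, by omega⟩
  have hd : HasSpectralDatum (wilsonFinTorusPartition r.ρ β L L L) :=
    tracePositive r hβ L L L (by omega) (by omega) (by omega)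
  unfold coldExcess; rw [hm]; exact exc_nonneg hd m

theorem coldDefect_le_one (r : LatticeRep G) {β : ℝ} (hβ : 0 ≤ β) {L : ℕ} (hL : 8 ≤ L) : coldDefect r.ρ β L ≤ 1 := by
  have h := coldDefect_le_one_sub_inv_sq r hβ hL
  have : 0 ≤ 1 / (1 + coldExcess r β L) ^ 2 := by positivity
  linarith

/-! ## §2 The femto tower (ONE physical stub, per representation) and the femto impurity it forces (PROVED equivalence) -/

/-- **Femto tower at `(G, r)`** — at every FIXED lattice box `L ≥ 8` the thermal trace excess of the cold box diverges as
`β → ∞`: `x_{⌊L/4⌋}(β, L³) → +∞` (the zero-mode / toron tower collapsing onto the ground state; route-posited predicate, the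
per-rep body of the stub `FemtoTowerSC`).  TRUE (physics-certain, rigorously open here) for every compact connected Lie `G` of
positive dimension and faithful `r` — `U(1)` INCLUDED (`x ≍ β^{3/2}`); FALSE for finite `G`. -/
def FemtoTowerAt (r : LatticeRep G) : Prop :=
  ∀ L : ℕ, 8 ≤ L → Tendsto (fun β : ℝ => coldExcess r β L) atTop atTop

/-- **Femto impurity at `(G, r)`** — at every FIXED lattice box `L ≥ 8` the cold purity defect tends to ONE as `β → ∞`
(route-posited predicate; equivalent to `FemtoTowerAt r`: `femtoImpurityAt_iff_femtoTowerAt`). -/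
def FemtoImpurityAt (r : LatticeRep G) : Prop :=
  ∀ L : ℕ, 8 ≤ L → Tendsto (fun β : ℝ => coldDefect r.ρ β L) atTop (𝓝 1)

/-- **Quantitative femto tower (typed rung, OPEN):** the excess grows at least like `c·β^κ`.  Morse–Bott count at the generic
flat stratum predicts `κ = 3·rank(G)/2` (plus possible logarithms from singular strata); for `U(1)`, where the flat set is smooth,
`κ = 3/2` exactly and the statement is a Gaussian/theta-function computation (the line's cheapest rung). -/
def FemtoRateAt (r : LatticeRep G) (κ : ℝ) : Prop :=
  ∀ L : ℕ, 8 ≤ L → ∃ c : ℝ, 0 < c ∧ ∃ β₁ : ℝ, ∀ β : ℝ, β₁ ≤ β → c * β ^ κ ≤ coldExcess r β L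

theorem femtoTowerAt_of_rate (r : LatticeRep G) {κ : ℝ} (hκ : 0 < κ) (h : FemtoRateAt r κ) : FemtoTowerAt r := by
  intro L hL
  obtain ⟨c, hc, β₁, hβ₁⟩ := h L hL
  have hpow : Tendsto (fun β : ℝ => c * β ^ κ) atTop atTop :=
    Tendsto.const_mul_atTop hc (tendsto_rpow_atTop hκ)
  refine tendsto_atTop_mono' atTop ?_ hpow
  exact (eventually_ge_atTop β₁).mono fun β hβ => hβ₁ β hβ

/-- **Tower ⇒ impurity** (PROVED): `x → ∞` and `δᶜ ≥ 1 − 1/(1+x)`, `δᶜ ≤ 1`. -/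
theorem femtoImpurityAt_of_tower (r : LatticeRep G) (h : FemtoTowerAt r) : FemtoImpurityAt r := by
  intro L hL
  have hx := h L hL
  -- lower envelope `1 - 1/(1+x β) → 1`
  have h1 : Tendsto (fun β : ℝ => 1 + coldExcess r β L) atTop atTop := tendsto_atTop_add_const_left _ 1 hx
  have h2 : Tendsto (fun β : ℝ => (1 + coldExcess r β L)⁻¹) atTop (𝓝 0) := h1.inv_tendsto_atTop
  have h3 : Tendsto (fun β : ℝ => 1 - 1 / (1 + coldExcess r β L)) atTop (𝓝 1) := by
    have := (tendsto_const_nhds (x := (1 : ℝ)) (f := (atTop : Filter ℝ))).sub h2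
    simpa only [one_div, sub_zero] using this
  refine tendsto_of_tendsto_of_tendsto_of_le_of_le' h3 tendsto_const_nhds ?_ ?_
  · exact (eventually_ge_atTop 0).mono fun β hβ => one_sub_inv_le_coldDefect r hβ hL
  · exact (eventually_ge_atTop 0).mono fun β hβ => coldDefect_le_one r hβ hL

/-- **Impurity ⇒ tower** (PROVED): `δᶜ → 1` and `1 − δᶜ ≥ 1/(1+x)²` force `x → ∞`. -/
theorem femtoTowerAt_of_impurity (r : LatticeRep G) (h : FemtoImpurityAt r) : FemtoTowerAt r := by
  intro L hL
  have hδ := h L hL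
  rw [tendsto_atTop]
  intro b
  -- WLOG `b ≥ 0`; eventually `δᶜ > 1 - 1/(1 + b')²` with `b' = max b 0`
  set b' : ℝ := max b 0 with hb'
  have hb'0 : 0 ≤ b' := le_max_right _ _
  have hlt : 1 - 1 / (1 + b') ^ 2 < 1 := by
    have : 0 < 1 / (1 + b') ^ 2 := by positivity
    linarith
  have hev : ∀ᶠ β : ℝ in atTop, 1 - 1 / (1 + b') ^ 2 < coldDefect r.ρ β L := hδ.eventually (Ioi_mem_nhds hlt)
  filter_upwards [hev, eventually_ge_atTop (0 : ℝ)] with β hβ hβ0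
  have hup := coldDefect_le_one_sub_inv_sq r hβ0 hL
  have hx0 := coldExcess_nonneg r hβ0 hL
  have hcmp : 1 / (1 + coldExcess r β L) ^ 2 < 1 / (1 + b') ^ 2 := by linarith
  have hpos : 0 < (1 + coldExcess r β L) := by linarith
  have hsq : (1 + b') ^ 2 < (1 + coldExcess r β L) ^ 2 := by
    by_contra hcon
    push Not at hcon
    have : 1 / (1 + b') ^ 2 ≤ 1 / (1 + coldExcess r β L) ^ 2 :=
      one_div_le_one_div_of_le (by positivity) hcon
    linarith
  have hb'x : b' < coldExcess r β L := by
    nlinarith [hsq, hb'0, hx0]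
  exact le_of_lt (lt_of_le_of_lt (le_max_left _ _) hb'x)

theorem femtoImpurityAt_iff_femtoTowerAt (r : LatticeRep G) : FemtoImpurityAt r ↔ FemtoTowerAt r :=
  ⟨femtoTowerAt_of_impurity r, femtoImpurityAt_of_tower r⟩

/-! ## §3 The wall (PROVED modulo the per-rep tower): no β-uniform witness, window escape, selectors diverge, no upward heredity -/

/-- **`E` with the box chosen BEFORE the coupling, at `(G, r)`:** SOME fixed lattice box `L ≥ 8` is `θ`-pure at ALL large `β`
(route-posited strengthening of the body of `BasinRung.ColdExitAt θ`; the form a β-UNIFORM finite-lattice argument would prove). -/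
def UniformExitAtRep (r : LatticeRep G) (θ : ℝ) : Prop :=
  ∃ L : ℕ, 8 ≤ L ∧ ∃ β₁ : ℝ, ∀ β : ℝ, β₁ ≤ β → coldDefect r.ρ β L ≤ θ

/-- **Upward heredity of purity in `β` at fixed lattice size, at `(G, r)`** — the β-REVERSAL of ideator idea-11's `M♭₂ =
BasinHereditySlackSC` (which transports purity DOWNWARD, `β' ↦ β ≤ β'`): beyond `β₀`, `ε`-purity of the box `L` at `β` gives
`ε'`-purity of the SAME lattice box at every `β' ≥ β` (route-posited predicate, refuted below given cofinal exits). -/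
def UpwardHeredityAtRep (r : LatticeRep G) (ε ε' : ℝ) : Prop :=
  ∃ β₀ : ℝ, ∀ β β' : ℝ, β₀ ≤ β → β ≤ β' → ∀ L : ℕ, 8 ≤ L → coldDefect r.ρ β L ≤ ε → coldDefect r.ρ β' L ≤ ε'

/-- **Eventual `θ`-impurity of every fixed box at `(G, r)`** — the WEAKEST hypothesis the wall needs at tolerance `θ`: for every lattice
box `L ≥ 8`, eventually in `β`, `δᶜ_β(L) > θ`.  Implied for every `θ < 1` by the femto tower (`eventualImpurityAt_of_femto`); for `θ < 1 − |Z(G)|⁻³`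
already implied by the degeneracy of 't Hooft's `|Z(G)|³` electric-flux sectors alone (`SU(2)`: `θ < 7/8`, rung `CentreFluxImpuritySU2` below). -/
def EventualImpurityAt (r : LatticeRep G) (θ : ℝ) : Prop :=
  ∀ L : ℕ, 8 ≤ L → ∀ᶠ β : ℝ in atTop, θ < coldDefect r.ρ β L

theorem eventualImpurityAt_of_femto (r : LatticeRep G) (hF : FemtoImpurityAt r) {θ : ℝ} (hθ : θ < 1) :
    EventualImpurityAt r θ :=
  fun L hL => (hF L hL).eventually (Ioi_mem_nhds hθ)

theorem eventualImpurityAt_mono (r : LatticeRep G) {θ θ' : ℝ} (hθθ' : θ' ≤ θ) (h : EventualImpurityAt r θ) :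
    EventualImpurityAt r θ' :=
  fun L hL => (h L hL).mono fun _ hβ => lt_of_le_of_lt hθθ' hβ

/-- **No β-uniform witness** (PROVED from eventual `θ`-impurity at `r`): no fixed lattice box is `θ`-pure at all large `β`. -/
theorem not_uniformExitAtRep (r : LatticeRep G) {θ : ℝ} (hI : EventualImpurityAt r θ) :
    ¬ UniformExitAtRep r θ := by
  rintro ⟨L, hL, β₁, h⟩
  obtain ⟨β, hβ, hβ₁⟩ := ((hI L hL).and (eventually_ge_atTop β₁)).exists
  exact absurd (h β hβ₁) (not_le.mpr hβ)

/-- **Trivial side of the threshold (PROVED):** for `θ ≥ 1` EVERY box is `θ`-pure (`δᶜ ≤ 1`), so the β-uniform form holds with `L = 8`, `β₁ = 0`. -/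
theorem uniformExitAtRep_of_one_le (r : LatticeRep G) {θ : ℝ} (hθ : 1 ≤ θ) : UniformExitAtRep r θ :=
  ⟨8, le_rfl, 0, fun _ hβ => (coldDefect_le_one r hβ (le_refl 8)).trans hθ⟩

/-- **Window escape** (PROVED from eventual `θ`-impurity at `r`): for every `L₁`, beyond some `β₂` NO box with `8 ≤ L ≤ L₁` is `θ`-pure —
the pure boxes leave every bounded window of lattice sizes. -/
theorem window_escape (r : LatticeRep G) {θ : ℝ} (hI : EventualImpurityAt r θ) (L₁ : ℕ) :
    ∃ β₂ : ℝ, ∀ β : ℝ, β₂ ≤ β → ∀ L : ℕ, 8 ≤ L → L ≤ L₁ → θ < coldDefect r.ρ β L := by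
  have hev : ∀ᶠ β : ℝ in atTop, ∀ L ∈ Finset.Icc 8 L₁, θ < coldDefect r.ρ β L := by
    rw [Filter.eventually_all_finset]
    intro L hLmem
    exact hI L (Finset.mem_Icc.mp hLmem).1
  obtain ⟨β₂, hβ₂⟩ := eventually_atTop.mp hev
  exact ⟨β₂, fun β hβ L hL hL₁ => hβ₂ β hβ L (Finset.mem_Icc.mpr ⟨hL, hL₁⟩)⟩

/-- **Every exit selector diverges** (PROVED from eventual `θ`-impurity at `r`): if `β ↦ L(β)` eventually witnesses `θ`-purity of the cold
box `L(β) ≥ 8`, then `L(β) → ∞` — in lattice units the pure boxes run away; `E` cannot be certified on a bounded family of lattices. -/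
theorem selector_tendsto_atTop (r : LatticeRep G) {θ : ℝ} (hI : EventualImpurityAt r θ) (f : ℝ → ℕ)
    (hf : ∀ᶠ β : ℝ in atTop, 8 ≤ f β ∧ coldDefect r.ρ β (f β) ≤ θ) : Tendsto f atTop atTop := by
  rw [tendsto_atTop]
  intro L₁
  obtain ⟨β₂, hβ₂⟩ := window_escape r hI L₁
  filter_upwards [hf, eventually_ge_atTop β₂] with β hβ hββ₂
  by_contra hcon
  push Not at hcon
  have := hβ₂ β hββ₂ (f β) hβ.1 hcon.le
  linarith [hβ.2]

/-- **No upward heredity** (PROVED from eventual `ε'`-impurity at `r`): if `θ`-pure cold boxes occur at cofinally many couplings (VERBATIM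
the per-rep body of idea-12's `ExitsUnboundedAt θ`, implied by the seed `ColdExitAt θ`), then purity is NOT inherited upward in `β` at fixed
lattice size: `¬ UpwardHeredityAtRep r θ ε'`.  (Downward heredity, idea-11's `M♭₂`, is untouched.) -/
theorem not_upwardHeredity (r : LatticeRep G) {θ ε' : ℝ} (hI : EventualImpurityAt r ε')
    (hK : ∀ β₁ : ℝ, ∃ β : ℝ, β₁ ≤ β ∧ ∃ L : ℕ, 8 ≤ L ∧ coldDefect r.ρ β L ≤ θ) :
    ¬ UpwardHeredityAtRep r θ ε' := by
  rintro ⟨β₀, h⟩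
  obtain ⟨β, hβ₀, L, hL, hδ⟩ := hK β₀
  obtain ⟨β', ⟨hlt, hββ'⟩⟩ := ((hI L hL).and (eventually_ge_atTop β)).exists
  exact absurd (h β β' hβ₀ hββ' L hL hδ) (not_le.mpr hlt)

/-- **RUNG (typed, OPEN; the line's cheapest prover target): centre-flux impurity of `SU(2)` boxes.**  For every `θ < 7/8` every fixed
lattice box of `SU(2)` (fundamental Wilson action) is eventually `θ`-impure: the `2³ = 8` electric-flux sectors ('t Hooft 1979) become
degenerate with the vacuum as `β → ∞` at fixed `L` (variational flux states: `E_e − E_0 ≲ C·L/β`), so `x ≥ 7 − o(1)` and `δᶜ ≥ 1 − 1/8 − o(1)`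
by `one_sub_inv_le_coldDefect`.  Weaker than the tower, enough to refute `UniformExit24` (`not_uniformExit24_of_centreRung`).  Route-posited. -/
def CentreFluxImpuritySU2 : Prop :=
  letI : MeasurableSpace (Matrix.specialUnitaryGroup (Fin 2) ℂ) := borel _
  haveI : BorelSpace (Matrix.specialUnitaryGroup (Fin 2) ℂ) := ⟨rfl⟩
  ∀ θ : ℝ, θ < 7 / 8 → EventualImpurityAt (fundamentalLatticeRep 2) θ

end Model

/-! ## §4 Class level: the stub, the refuted strengthening of the seed, the selector theorem for `E` -/

/-- **STUB `FemtoTowerSC` — the femto tower for every compact simple `G`** (NO simply-connectedness binder: the phenomenon is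
group-blind within compact connected Lie groups — `SO(3)`, `U(1)×…` alike; it USES connectedness / positive dimension, which
`IsCompactSimpleLieGroup` guarantees; FALSE for finite groups).  Route-posited obligation; physics-certain; the tree has the transfer
matrix (`tracePositive`) but not yet the Laplace/zero-mode asymptotics of `wilsonFinTorusPartition` at fixed volume.
Why it might fail: only through a mis-typing (it cannot fail for `dim G ≥ 1` if the femto-universe spectrum is what every weak-coupling
analysis says); the honest risk is PROVABILITY (singular strata of the commuting variety enter the Laplace exponent — they change the
rate, not the divergence).  Sources: Luscher1983 (NPB 219, 233), vanBaalKoller1987, CosteEtAl1985 (NPB 262, 67), GonzalezArroyoKorthalsAltes1988. -/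
def FemtoTowerSC : Prop :=
  ∀ (G : Type) [Group G] [TopologicalSpace G] [IsTopologicalGroup G] [CompactSpace G],
    IsCompactSimpleLieGroup G →
    letI : MeasurableSpace G := borel G
    haveI : BorelSpace G := ⟨rfl⟩
    ∀ r : LatticeRep G, FemtoTowerAt r

/-- **`UniformExitAt θ` — the seed `ColdExitAt θ` with the quantifiers `∃ L` / `∀ β` SWAPPED** (box before coupling), on `E`'s own
class (compact simple simply-connected `G`, every lattice representation).  A strengthening of the seed (`coldExitAt_of_uniformExitAt`);
FALSE for every `θ < 1` modulo `FemtoTowerSC` (`not_uniformExitAt_SU2`).  Route-posited NEGATIVE target, not a published statement. -/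
def UniformExitAt (θ : ℝ) : Prop :=
  ∀ (G : Type) [Group G] [TopologicalSpace G] [IsTopologicalGroup G] [CompactSpace G],
    IsCompactSimpleLieGroup G → SimplyConnectedSpace G →
    letI : MeasurableSpace G := borel G
    haveI : BorelSpace G := ⟨rfl⟩
    ∀ r : LatticeRep G, UniformExitAtRep r θ

/-- The β-uniform form at the desk's tolerance of record `1/24` (closed Prop for the tautology probe). -/
def UniformExit24 : Prop := UniformExitAt (1 / 24)

/-- `UniformExitAt θ` IS a strengthening of the seed `ColdExitAt θ` (swap the quantifiers back). -/
theorem coldExitAt_of_uniformExitAt {θ : ℝ} (h : UniformExitAt θ) : ColdExitAt θ := by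
  intro G _ _ _ _ hG hsc
  letI : MeasurableSpace G := borel G
  haveI : BorelSpace G := ⟨rfl⟩
  intro r
  obtain ⟨L, hL, β₁, hβ₁⟩ := h G hG hsc r
  exact ⟨β₁, fun β hβ => ⟨L, hL, hβ₁ β hβ⟩⟩

/-- **The strengthening is refuted at `SU(2)`** (PROVED modulo the stub `FemtoTowerSC` and the binder fact `π₁(SU(2)) = 1`, i.e.
`SU(2) ≅ S³`, Bröcker–tom Dieck V (7.13) — not in the tree, carried as a hypothesis): for every `θ < 1`, `¬ UniformExitAt θ`. -/
theorem not_uniformExitAt_SU2 (hF : FemtoTowerSC)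
    (hsc : SimplyConnectedSpace (Matrix.specialUnitaryGroup (Fin 2) ℂ)) {θ : ℝ} (hθ : θ < 1) :
    ¬ UniformExitAt θ := by
  intro hU
  have hG : IsCompactSimpleLieGroup (Matrix.specialUnitaryGroup (Fin 2) ℂ) :=
    isCompactSimpleLieGroup_specialUnitaryGroup isSimpleCompactGroup_specialUnitaryGroup_holds le_rfl
  letI : MeasurableSpace (Matrix.specialUnitaryGroup (Fin 2) ℂ) := borel _
  haveI : BorelSpace (Matrix.specialUnitaryGroup (Fin 2) ℂ) := ⟨rfl⟩
  have hUr : UniformExitAtRep (fundamentalLatticeRep 2) θ := hU _ hG hsc (fundamentalLatticeRep 2)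
  have hFr : FemtoTowerAt (fundamentalLatticeRep 2) := hF _ hG (fundamentalLatticeRep 2)
  exact not_uniformExitAtRep _ (eventualImpurityAt_of_femto _ (femtoImpurityAt_of_tower _ hFr) hθ) hUr

/-- **Trivial side, class level (PROVED):** `UniformExitAt θ` for every `θ ≥ 1`, hence `ColdExitAt θ` for `θ ≥ 1` outright (group-blind). -/
theorem uniformExitAt_of_one_le {θ : ℝ} (hθ : 1 ≤ θ) : UniformExitAt θ := by
  intro G _ _ _ _ hG hsc
  letI : MeasurableSpace G := borel G
  haveI : BorelSpace G := ⟨rfl⟩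
  intro r
  exact uniformExitAtRep_of_one_le r hθ

theorem coldExitAt_of_one_le {θ : ℝ} (hθ : 1 ≤ θ) : ColdExitAt θ :=
  coldExitAt_of_uniformExitAt (uniformExitAt_of_one_le hθ)

/-- **SHARP THRESHOLD on the tolerance axis (PROVED modulo `FemtoTowerSC` + `π₁(SU(2)) = 1`): `UniformExitAt θ ↔ 1 ≤ θ`.**  The seed with the
box chosen before the coupling holds exactly in the trivial range — the wall is optimal in `θ`. -/
theorem uniformExitAt_iff_one_le (hF : FemtoTowerSC)
    (hsc : SimplyConnectedSpace (Matrix.specialUnitaryGroup (Fin 2) ℂ)) {θ : ℝ} :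
    UniformExitAt θ ↔ 1 ≤ θ :=
  ⟨fun h => not_lt.mp fun hθ => not_uniformExitAt_SU2 hF hsc hθ h, uniformExitAt_of_one_le⟩

/-- **`UniformExit24` is refuted already by the centre rung** (PROVED modulo `CentreFluxImpuritySU2` and `π₁(SU(2)) = 1`): the eight
electric-flux sectors of `SU(2)` suffice at the desk's tolerance `1/24 < 7/8`; the full tower is not needed for the headline. -/
theorem not_uniformExit24_of_centreRung (hC : CentreFluxImpuritySU2)
    (hsc : SimplyConnectedSpace (Matrix.specialUnitaryGroup (Fin 2) ℂ)) : ¬ UniformExit24 := by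
  intro hU
  have hG : IsCompactSimpleLieGroup (Matrix.specialUnitaryGroup (Fin 2) ℂ) :=
    isCompactSimpleLieGroup_specialUnitaryGroup isSimpleCompactGroup_specialUnitaryGroup_holds le_rfl
  letI : MeasurableSpace (Matrix.specialUnitaryGroup (Fin 2) ℂ) := borel _
  haveI : BorelSpace (Matrix.specialUnitaryGroup (Fin 2) ℂ) := ⟨rfl⟩
  have hUr : UniformExitAtRep (fundamentalLatticeRep 2) (1 / 24) := hU _ hG hsc (fundamentalLatticeRep 2)
  exact not_uniformExitAtRep _ (hC (1 / 24) (by norm_num)) hUr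

/-- **The selector theorem for the seed** (PROVED modulo `FemtoTowerSC`): on `E`'s class, if `ColdExitAt θ` holds with `θ < 1`
then at every `(G, r)` there IS a selector and EVERY selector `β ↦ L(β)` (eventually `8 ≤ L(β)`, `δᶜ_β(L(β)) ≤ θ`) tends to `+∞`:
the witnesses of `E` diverge in lattice units — a unit map / multi-scale passage is forced on any proof of `E`. -/
theorem exitSelectors_diverge (hF : FemtoTowerSC) {θ : ℝ} (hθ : θ < 1) (hE : ColdExitAt θ)
    (G : Type) [Group G] [TopologicalSpace G] [IsTopologicalGroup G] [CompactSpace G]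
    (hG : IsCompactSimpleLieGroup G) (hsc : SimplyConnectedSpace G) :
    letI : MeasurableSpace G := borel G
    haveI : BorelSpace G := ⟨rfl⟩
    ∀ r : LatticeRep G,
      (∃ f : ℝ → ℕ, ∀ᶠ β : ℝ in atTop, 8 ≤ f β ∧ coldDefect r.ρ β (f β) ≤ θ) ∧
      ∀ f : ℝ → ℕ, (∀ᶠ β : ℝ in atTop, 8 ≤ f β ∧ coldDefect r.ρ β (f β) ≤ θ) → Tendsto f atTop atTop := by
  letI : MeasurableSpace G := borel G
  haveI : BorelSpace G := ⟨rfl⟩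
  intro r
  have hFr : FemtoImpurityAt r := femtoImpurityAt_of_tower r (hF G hG r)
  refine ⟨?_, fun f hf => selector_tendsto_atTop r (eventualImpurityAt_of_femto r hFr hθ) f hf⟩
  obtain ⟨β₁, hβ₁⟩ := hE G hG hsc r
  classical
  refine ⟨fun β => if h : β₁ ≤ β then (hβ₁ β h).choose else 8, ?_⟩
  filter_upwards [eventually_ge_atTop β₁] with β hβ
  simp only [dif_pos hβ]
  exact (hβ₁ β hβ).choose_spec

/-- **No upward heredity on the class** (PROVED modulo `FemtoTowerSC`): given the seed `ColdExitAt θ`, at every `(G, r)` of `E`'s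
class and every `ε' < 1`, `¬ UpwardHeredityAtRep r θ ε'`. -/
theorem not_upwardHeredity_of_exitAt (hF : FemtoTowerSC) {θ ε' : ℝ} (hε' : ε' < 1) (hE : ColdExitAt θ)
    (G : Type) [Group G] [TopologicalSpace G] [IsTopologicalGroup G] [CompactSpace G]
    (hG : IsCompactSimpleLieGroup G) (hsc : SimplyConnectedSpace G) :
    letI : MeasurableSpace G := borel G
    haveI : BorelSpace G := ⟨rfl⟩
    ∀ r : LatticeRep G, ¬ UpwardHeredityAtRep r θ ε' := by
  letI : MeasurableSpace G := borel G
  haveI : BorelSpace G := ⟨rfl⟩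
  intro r
  have hFr : FemtoImpurityAt r := femtoImpurityAt_of_tower r (hF G hG r)
  refine not_upwardHeredity r (eventualImpurityAt_of_femto r hFr hε') fun β₁ => ?_
  obtain ⟨β₀, hβ₀⟩ := hE G hG hsc r
  obtain ⟨L, hL, hδ⟩ := hβ₀ (max β₀ β₁) (le_max_left _ _)
  exact ⟨max β₀ β₁, le_max_right _ _, L, hL, hδ⟩

/-! ## §5 Bill of record (by name) and the registered stubs of this line -/

/-- STUB (this line's physical obligation, group-blind): the femto tower. -/
theorem stub_femtoTower : FemtoTowerSC := by
  sorry

/-- STUB `E₂₄` = `BasinRung.ColdExitAt (1/24)` — the seed of record (line 10 / FIFTH RUNG p604479), by name. -/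
theorem stub_coldExitAt24 : ColdExitAt (1 / 24) := by
  sorry

/-- STUB `X` = `ColdPressurePincer.AFToColdPressure`, by name. -/
theorem stub_afToColdPressure : AFToColdPressure := by
  sorry

/-- STUB `N` = `ColdPressurePincer.IRnsc`, by name. -/
theorem stub_irnsc : IRnsc := by
  sorry

/-- The leaf BY NAME through the bill of record `IR_of_exitAt24` (the femto wall adds NO width: it constrains the shape of any proof
of `stub_coldExitAt24` — its witnesses diverge in lattice units, `exitSelectors_diverge`). -/
theorem IR_of_stubs : Summit.QuantumFields.YangMills.Theses.BalabanLadder.IR :=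
  IR_of_exitAt24 stub_coldExitAt24 stub_afToColdPressure stub_irnsc

/-- What the two stubs say together (kernel-checked composition): every witness family of the seed runs away in lattice units. -/
theorem seedWitnesses_diverge
    (G : Type) [Group G] [TopologicalSpace G] [IsTopologicalGroup G] [CompactSpace G]
    (hG : IsCompactSimpleLieGroup G) (hsc : SimplyConnectedSpace G) :
    letI : MeasurableSpace G := borel G
    haveI : BorelSpace G := ⟨rfl⟩
    ∀ r : LatticeRep G, ∀ f : ℝ → ℕ, (∀ᶠ β : ℝ in atTop, 8 ≤ f β ∧ coldDefect r.ρ β (f β) ≤ 1 / 24) →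
      Tendsto f atTop atTop :=
  fun r f hf => ((exitSelectors_diverge stub_femtoTower (by norm_num) stub_coldExitAt24 G hG hsc) r).2 f hf

end Summit.QuantumFields.YangMills.Cruxes.IR.FemtoWall

end
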